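import Summits.ABC.IUTFork.Cor312PinnedCountermodel
import Summits.ABC.IUTFork.Cor312StatementPilotNounsReading4
import HarnessLib

/-!
# [IUTchIII] Cor. 3.12 — the pinned countermodel (PR-2) refutes the M-APEX LICENCE at its own nouns ((G3″) in apex currency)

PROOF-ONLY file (no definition, no `Prop` fact) of the abc-iut cell (wave-5 prover seat abc-iut-w5-d235, gen 2; sequel of
`Cor312StatementPilotNounsAdm` v3 and of abc-iut-w4-d101's PR-2 `Cor312PinnedCountermodel`, p418585 ff.). TAKES NO SIDE on
[IUTchIII] Cor. 3.12.

abc-iut-c312-2's kernel-DAG apex `DAG.summit_of_cor312_M` derives `ABC` from, per curve, a typed situation of [IUTchIII]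
Thm. 3.11 with pilot nouns `Pn`, componentwise admissibility `hadm`, two finiteness clauses, identifications `hΘ`/`hq`, and THE
LICENCE `hLic : ∀ j v_ℚ, (Pn.toCor312Setting n m j v_ℚ _).QSubHull` (skel's Reading 2 of Step (xi-f); variant
`summit_of_cor312_M_represented` with Reading 1 `RepresentedVol`). By `Cor312StatementPilotNounsAdm` (v1–v3) at the nouns
`P.toPilotNouns` of any `Cor312.Setting P` with abc-iut-c312-6's `BridgeHyps`, `hadm` holds and the licence at every component
implies the printed `Statement`; contrapositively every `BridgeHyps ∧ ¬Statement` setting refutes the licence at some component.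
THIS FILE instantiates the contrapositive at PR-2's PINNED countermodel (director-abc 2026-08-26T01:56:18Z «PINNED-REGIONS ROUND»;
abc-iut-w4-d101 `PinnedWitness.pinnedSetting`: honest object side, regions READ OFF the pilot objects, the three printed pins
`PinnedRegions3`, typed Thm. 3.11 (i)–(iii) `naiveFull_statement`, `BridgeHyps`, `|log(q)| > 0`, `¬Statement`):

* `pinnedSetting_exists_not_qSubHull_toPilotNouns` / `…_not_representedVol_…` — at the pinned setting's nouns, for every column
  `m`, SOME component `(j, v_ℚ)` violates the apex licence (Reading 2), resp. its Reading-1 variant;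
* `Cor312.Setting.qSubHull_toPilotNouns_of_gapA''` — the positive tine: PinnedRegions ∧ GapA″ ∧ BridgeHyps ⟹ the apex licence at every
  component (any setting);
* `pinned_countermodel_refutes_apex_licence` — PACKAGED: there are an index `T`, a full situation `F` of Thm. 3.11 with
  `F.Statement` (typed (i) ∧ (ii) ∧ (iii)), and a setting `P` over it with `BridgeHyps P ∧ P.AbsLogQPos ∧ PinnedRegions3 …` such that
  for EVERY column `m` the apex licence of `summit_of_cor312_M` at `Pn := P.toPilotNouns`, `n := P.n` FAILS at some component, and so
  does the Reading-1 licence of `summit_of_cor312_M_represented`.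

READING (neutral): the apex's one disputed hypothesis `hLic` is NOT a consequence of «typed Thm. 3.11 + BridgeHyps + the three
printed pins + |log(q)| > 0» at the interface level — the (G3″) sentence of ADJUDICATION-SPEC v2.3 stated for the apex's own licence.
Interface-level witness over `toyIndex` (one place, `l⋇ = 2`); NOT initial Θ-data; no judgement on print. [claim: Mochizuki2012, status:
disputed] for the quoted objects; [cite: ScholzeStix2018, §2.2 pp. 9–10] for the shape of the model.
-/

noncomputable section

namespace Summit.ABC.IUTFork.Cor312.Setting

open Thm311 Cor312Vol Literature.IUT.LogThetaLattice

/-- **The positive tine in apex currency**: at the nouns of ANY setting with the bridge hypotheses, abc-iut-w5-d230's sharpened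
gap `GapA″` under the pins yields the apex licence (skel's Reading 2 `QSubHull`) at EVERY component and every column `m` — R3 at
the setting ⟹ Reading 2 at the components (`qSubHull_toPilotNouns_of_mem_possibleImages`). [claim: Mochizuki2012, status: disputed] -/
theorem qSubHull_toPilotNouns_of_gapA'' {T : ThetaIndex} {S : LatticeSituation T} {P : Setting S.toSituation} (H : BridgeHyps P)
    (ρ : (∀ v : T.V, v ∈ T.Vbad → Set (S.L.StarPacket v)) → ∀ (j : T.Label) (vQ : T.VQ), Set (S.L.Packet j vQ))
    (qK : ∀ v : T.V, v ∈ T.Vbad → Set (S.L.StarPacket v)) (hpin : PinnedRegions S P ρ qK) (hgap : GapA'' S P ρ qK)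
    (m : ℤ) (j : T.LabelStar) (vQ : T.VQ) :
    (P.toPilotNouns.toCor312Setting P.n m j vQ (componentAdm_toPilotNouns_of_bridgeHyps H m j vQ)).QSubHull :=
  qSubHull_toPilotNouns_of_mem_possibleImages H m j vQ (hgap hpin j.1 vQ)

end Summit.ABC.IUTFork.Cor312.Setting

namespace Summit.ABC.IUTFork.Cor312Vol.PinnedWitness

open Thm311 Cor312 Cor312.Setting Cor312.Checks NaiveWitness Literature.IUT.LogThetaLattice

variable (p : ℕ) [hp : Fact p.Prime]

/-- **At the pinned countermodel the apex licence (Reading 2) FAILS at some component**, for every column `m`.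
[claim: Mochizuki2012, status: disputed] -/
theorem pinnedSetting_exists_not_qSubHull_toPilotNouns (m : ℤ) :
    ∃ (j : toyIndex.LabelStar) (vQ : toyIndex.VQ),
      ¬ ((toPilotNouns (S := (naiveFull p).toLatticeSituation) (pinnedSetting p)).toCor312Setting (pinnedSetting p).n m j vQ
          (componentAdm_toPilotNouns_of_bridgeHyps (S := (naiveFull p).toLatticeSituation) (P := pinnedSetting p)
            (pinnedSetting_bridgeHyps p) m j vQ)).QSubHull :=
  exists_not_qSubHull_toPilotNouns_of_not_statement (S := (naiveFull p).toLatticeSituation) (P := pinnedSetting p)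
    (pinnedSetting_bridgeHyps p) (pinnedSetting_not_statement p) m

/-- **… and the Reading-1 licence (`RepresentedVol`) fails at some component**, for every column `m`.
[claim: Mochizuki2012, status: disputed] -/
theorem pinnedSetting_exists_not_representedVol_toPilotNouns (m : ℤ) :
    ∃ (j : toyIndex.LabelStar) (vQ : toyIndex.VQ),
      ¬ ((toPilotNouns (S := (naiveFull p).toLatticeSituation) (pinnedSetting p)).toCor312Setting (pinnedSetting p).n m j vQ
          (componentAdm_toPilotNouns_of_bridgeHyps (S := (naiveFull p).toLatticeSituation) (P := pinnedSetting p)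
            (pinnedSetting_bridgeHyps p) m j vQ)).RepresentedVol :=
  exists_not_representedVol_toPilotNouns_of_not_statement (S := (naiveFull p).toLatticeSituation) (P := pinnedSetting p)
    (pinnedSetting_bridgeHyps p) (pinnedSetting_not_statement p) m

/-- R2 fails at some component of the pinned setting: the `q`-pilot region is not inside the hull of the possible images there.
[claim: Mochizuki2012, status: disputed] -/
theorem pinnedSetting_exists_not_qRegion_subset_thetaHull :
    ∃ (j : toyIndex.LabelStar) (vQ : toyIndex.VQ),
      ¬ ((pinnedSetting p).qRegion j.1 vQ ⊆ (pinnedSetting p).thetaHull j.1 vQ) :=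
  exists_not_qRegion_subset_thetaHull_of_not_statement (S := (naiveFull p).toLatticeSituation) (P := pinnedSetting p)
    (pinnedSetting_bridgeHyps p) (pinnedSetting_not_statement p)

/-- **PACKAGED ((G3″) in apex currency).** There are an index skeleton, a full situation `F` of [IUTchIII] Thm. 3.11 whose typed
`Statement` ((i) ∧ (ii) ∧ (iii)) HOLDS, and a Cor.-3.12 setting `P` over it satisfying abc-iut-c312-6's `BridgeHyps`, `|log(q)| > 0`
and the THREE PRINTED PINS (`PinnedRegions3`, abc-iut-w5-d230) for an honest non-constant region operator `ρ` and a nonempty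
q-datum `qK`, such that for EVERY column `m` the licence `hLic` of `DAG.summit_of_cor312_M` at `Pn := P.toPilotNouns`, `n := P.n` —
skel's Reading 2 `QSubHull` at every component — FAILS at some component, and so does the Reading-1 licence of
`summit_of_cor312_M_represented`; the printed `Statement` fails there too. Witness = abc-iut-w4-d101's pinned naive model at `p = 2`.
[claim: Mochizuki2012, status: disputed] -/
theorem pinned_countermodel_refutes_apex_licence :
    ∃ (T : ThetaIndex) (F : FullSituation T) (P : Setting F.toLatticeSituation.toSituation) (H : BridgeHyps P)
      (ρ : (∀ v : T.V, v ∈ T.Vbad → Set (F.L.StarPacket v)) → ∀ (j : T.Label) (vQ : T.VQ), Set (F.L.Packet j vQ))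
      (qK : ∀ v : T.V, v ∈ T.Vbad → Set (F.L.StarPacket v)),
      F.Statement ∧ P.AbsLogQPos ∧ PinnedRegions3 F.toLatticeSituation P ρ qK ∧
      (∃ (j : T.Label) (vQ : T.VQ), ρ (fun _ _ => ∅) j vQ ≠ ρ (F.D P.n).Ψ j vQ) ∧
      (∀ (v : T.V) (hv : v ∈ T.Vbad), (qK v hv).Nonempty) ∧
      ¬ P.Statement ∧
      (∀ m : ℤ, ∃ (j : T.LabelStar) (vQ : T.VQ),
        ¬ (P.toPilotNouns.toCor312Setting P.n m j vQ (componentAdm_toPilotNouns_of_bridgeHyps H m j vQ)).QSubHull) ∧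
      (∀ m : ℤ, ∃ (j : T.LabelStar) (vQ : T.VQ),
        ¬ (P.toPilotNouns.toCor312Setting P.n m j vQ (componentAdm_toPilotNouns_of_bridgeHyps H m j vQ)).RepresentedVol) := by
  haveI : Fact (Nat.Prime 2) := ⟨Nat.prime_two⟩
  exact ⟨toyIndex, naiveFull 2, pinnedSetting 2, pinnedSetting_bridgeHyps 2, orbitRegion 2, qDatum 2, naiveFull_statement 2,
    pinnedSetting_absLogQPos 2, pinnedSetting_pinnedRegions3 2, orbitRegion_separates 2, fun v _ => ⟨_, qTuple_mem_qDatum 2 v⟩,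
    pinnedSetting_not_statement 2, pinnedSetting_exists_not_qSubHull_toPilotNouns 2,
    pinnedSetting_exists_not_representedVol_toPilotNouns 2⟩

end Summit.ABC.IUTFork.Cor312Vol.PinnedWitness

end
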